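/- Copyright: the b2b-balaban cell (near-miss cell 7), T⁴-continuum fan-out, ROUND-2 swarm of lineage t4-ne7b-p1
(node U5c COUNT member), seat t4-ne7b-formalise-leaf-04.  Released under the licence of the surrounding project. -/
import Summits.QuantumFields.BalabanUV.T4Continuum.Support.HistoryConstantsSlack

/-!
# History constants: merger surcharges paid by the absorbed roots' slack — print's one-time connector (sub-row S9c, file 2)

Summits-side support leaf of the T⁴-continuum cell (rung (B)+1 on a FINITE torus only; NOT infinite volume, NOT the
mass gap, NOT the Clay statement; NOT a proof of the spine estimate NE7b).  Claim table
`t4/b2b-balaban-t4-ne7b-p1/LEAVES-NE7b.md`, sub-row S9c of S9 (file 2 of `HistoryConstantsSlack`).  [folklore] real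
arithmetic and finite sums over the lineage's own carrier; nothing printed is asserted beyond the shapes LOCATED in
`HistoryConstants`; no `Prop`-valued fact of Bałaban's is minted; no constant is specialised (c1∕c2∕c6).

WHY.  The last ARITHMETIC item of S9's displayed residue (ID-a): print charges the CONNECTOR «− O(1)2dM^dR^{d+1}_{j+1}»
((1.87) p. 387, from «d′_{j+1}(X) + d′_{j+1}(Y) + 2d ≥ d′_{j+1}(Z)» p. 386) ONCE, at the merger step, whereas the
dictionary books a connector size epoch opening one step later (`Dominates.connector_le_sz`: window `R_{j+2}` for
`R_{j+1}`, and nothing at all when the merger is the last performed step).  Print itself pays the connector from the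
merger's surplus, i.e. from the absorbed root's reserve.  Here the connector is booked the same way on the CREDIT side:
every merger's surcharge is charged to the SLACK `(½γ₀A₁² − a)·p₀(g_j)²·(d′+1)` of the root it ABSORBS (a birth at a
step `j ≤` the merger step), and the two roots of a merger are re-booked as (kept, absorbed) exactly as in
`T4BankedInduction.reserve_merge`.  No matching or injectivity argument is needed: the structural induction IS the
matching (each root is absorbed at most once).

WHAT.  §1 `MergePaid τ σ G` (at every merge node the merger label's surcharge `σ e` is below the budget `τ` of the
absorbed root), **`merges_surcharge_add_root_le`**: `FreshT G → MergePaid τ σ G → Σ_{e ∈ merges G} σ e + τ (root G) ≤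
Σ_{e ∈ events G} τ e` for any nonnegative budget `τ`; with `τ := slackT ∘ sh` (and print's credit = model's + slack):
**`creditsT_merges_surcharge_le`**; the TH shape absorbs `e^{Σ_{mergers} σ}`: **`pshapeTH_mul_exp_le_shapeTH_of_credits`**
(generic: any `A` with `credits (credit ∘ sh) + A ≤ credits (pcredit ∘ sh)`), **`pshapeTH_mul_exp_merges_le_shapeTH`**;
a SHARED budget form `creditsT_births_merges_le` (birth surcharges `σb` and merger surcharges `σm` together, the slack
split as `σb e + τ e ≤ slackT`).  §2 THE CONNECTOR INSTANCE: `mergePaid_connector_of_clause` — under `ConsistentT`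
(absorbed root = a birth no later than the merger, `ConsistentT.absorbed_spec`) the displayed TWO-SCALE γ-clause
`hcl : ∀ j ≤ s ≤ K, o87·2d·M^d·R_s^{d+1} ≤ (½γ₀A₁² − a)·p₀(g_j)²` books every connector on its absorbed root; and
**`connectorClause_of_threshold`** — `hcl` DERIVED from the typed (2.7) (`B14.FlowIneq27` at exponent `p₀`:
`p₀(g_s)² ≤ (1+β₀)²·p₀(g_j)²` for `j ≤ s`), (2.5) at `s` (`B14.IsRj`, `R_s ≤ L·(log g_s⁻²)^r`), `1 ≤ log g_s⁻²`, exponent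
room `r·(d+1) + 1 ≤ 2p₀` (R9∕(X7)) and ONE symbolic infrared threshold
`connectorThreshold O C L β₀ := max 1 (o87·2d·M^d·L^{d+1}·(1+β₀)² ∕ ((½γ₀A₁² − a)·A₀²)) ≤ log g_s⁻²`.  §3 sanity.

HONEST.  As for file 1: the IDENTIFICATION of print's connector with a surcharge on the merged structure stays with
the reading H3 (displayed by the consumer); what leaves the displayed residue is its absorption, at ANY merger step
including the last performed one, with an explicit threshold.  After this file the (ID-a) items of S9's header that
remain purely READINGS are the smallness of renewed ∕ post-epoch ∕ extended domains and (1.88)'s `R_{j+1}` for `R_n`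
(G-f2.6 RESOLVED).  NE7b NOT proved; spine 0∕9.  HONEST DEPENDENCY (cell): continuum YM on T⁴ ⇐ BetaPertH ∧ nine spine
estimates (0/9 proved); BetaPertH ⇐ (D1) ∧ (D4) ∧ CAP+tail; G-an2-4 gates asym, D1 and NE2/3/4.
-/

open Finset
open Literature.MathematicalPhysics.QuantumFieldTheory.Balaban1983to89
open T4PersistenceDictionary T4PersistentHistoryCount T4BankedInduction T4PrintedShapeBanking T4PartnerMultiplicity
open T4TaggedShapeBanking
open Summit.QuantumFields.BalabanUV.T4Continuum.LateMergers
open Summit.QuantumFields.BalabanUV.T4Continuum.Crowding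

namespace Summit.QuantumFields.BalabanUV.T4Continuum.HistoryConstants

noncomputable section

/-! ## §1 Merger surcharges against the absorbed roots' budget -/

section Merges

variable {ε : Type*} [DecidableEq ε] {C : T4PrintedShapeBanking.Consts} {O : PrintedO1s} (sh : ε → PEv)

/-- **`MergePaid τ σ G`**: at every merge node of `G` the merger label's surcharge `σ e` is at most the budget `τ` of
the ABSORBED root (`T4BankedInduction.absorbed`: the partner root that stops being a root). [folklore] -/
def MergePaid (τ σ : ε → ℝ) : Gen ε → Prop
  | Gen.born _ _ => True
  | Gen.renew G _ _ => MergePaid τ σ G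
  | Gen.merge X Y e => MergePaid τ σ X ∧ MergePaid τ σ Y ∧ σ e ≤ τ (absorbed X Y)

omit [DecidableEq ε] in
/-- `MergePaid` is monotone in the budget. [folklore] -/
theorem MergePaid.mono {τ τ' σ : ε → ℝ} (hle : ∀ e, τ e ≤ τ' e) : ∀ {G : Gen ε}, MergePaid τ σ G → MergePaid τ' σ G
  | Gen.born _ _, _ => trivial
  | Gen.renew G _ _, h => MergePaid.mono hle (G := G) h
  | Gen.merge _ _ _, h => ⟨MergePaid.mono hle h.1, MergePaid.mono hle h.2.1, h.2.2.trans (hle _)⟩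

/-- **MERGER SURCHARGES PLUS THE SURVIVING ROOT'S BUDGET ARE BELOW THE TOTAL BUDGET** (nonnegative budget, fresh
genealogy): the two roots of a merger re-booked as (kept, absorbed) by `reserve_merge`; no matching needed. [folklore] -/
theorem merges_surcharge_add_root_le {τ σ : ε → ℝ} (hτ : ∀ e, 0 ≤ τ e) :
    ∀ {G : Gen ε}, FreshT G → MergePaid τ σ G → ∑ e ∈ merges G, σ e + τ G.root ≤ ∑ e ∈ G.events, τ e
  | Gen.born b j, _, _ => by simp [merges]
  | Gen.renew G e h, hF, hM => by
      simp only [FreshT] at hF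
      simp only [MergePaid] at hM
      rw [merges, root_renew, Gen.events_renew, sum_insert hF.2]
      have ih := merges_surcharge_add_root_le hτ hF.1 hM
      linarith [hτ e]
  | Gen.merge X Y e, hF, hM => by
      simp only [FreshT] at hF
      simp only [MergePaid] at hM
      obtain ⟨hX, hY, heX, heY, hd⟩ := hF
      obtain ⟨hMX, hMY, hσ⟩ := hM
      have ihX := merges_surcharge_add_root_le hτ hX hMX
      have ihY := merges_surcharge_add_root_le hτ hY hMY
      have hem : e ∉ merges X ∪ merges Y := fun h => by
        rcases mem_union.1 h with h | h
        · exact heX (merges_subset_events X h)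
        · exact heY (merges_subset_events Y h)
      have hdm : Disjoint (merges X) (merges Y) :=
        Disjoint.mono (merges_subset_events X) (merges_subset_events Y) hd
      have hev : e ∉ X.events ∪ Y.events := by simp [heX, heY]
      rw [merges, sum_insert hem, sum_union hdm, Gen.events_merge, sum_insert hev, sum_union hd]
      have hr := reserve_merge τ X Y e
      linarith [hτ e]

/-- **THE MODEL'S CREDITS PLUS THE MERGER SURCHARGES ARE BELOW PRINT'S CREDITS** when every merger is paid by its absorbed
root's slack (`a ≤ ½γ₀A₁²`, fresh genealogy). [folklore] -/
theorem creditsT_merges_surcharge_le (hb : C.a ≤ O.γ₀ * O.A₁ ^ 2 / 2) (g : ℕ → ℝ) {σ : ε → ℝ} {G : Gen ε}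
    (hF : FreshT G) (hM : MergePaid (fun e => slackT O C g (sh e)) σ G) :
    credits (credit C g ∘ sh) G + ∑ e ∈ merges G, σ e ≤ credits (pcredit O C g ∘ sh) G := by
  rw [creditsT_eq_add_slack sh g G]
  have h := merges_surcharge_add_root_le (τ := fun e => slackT O C g (sh e)) (fun e => slackT_nonneg hb g (sh e)) hF hM
  have h0 := slackT_nonneg hb g (sh G.root)
  linarith

/-- **SHARED BUDGET**: birth surcharges `σb` (charged at every event, `≤ slack − τ`) and merger surcharges `σm` (charged to
the absorbed roots' share `τ ≥ 0`) together stay below print's credits. [folklore] -/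
theorem creditsT_births_merges_le (g : ℕ → ℝ) {τ σb σm : ε → ℝ} (hτ : ∀ e, 0 ≤ τ e) {G : Gen ε} (hF : FreshT G)
    (hb : ∀ e ∈ G.events, σb e + τ e ≤ slackT O C g (sh e)) (hM : MergePaid τ σm G) :
    credits (credit C g ∘ sh) G + (∑ e ∈ G.events, σb e + ∑ e ∈ merges G, σm e) ≤ credits (pcredit O C g ∘ sh) G := by
  rw [creditsT_eq_add_slack sh g G]
  have h1 := merges_surcharge_add_root_le hτ hF hM
  have h2 : ∑ e ∈ G.events, σb e + ∑ e ∈ G.events, τ e ≤ ∑ e ∈ G.events, slackT O C g (sh e) := by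
    rw [← sum_add_distrib]; exact sum_le_sum hb
  linarith [hτ G.root]

/-- **THE TH SHAPE ABSORBS ANY CREDIT-PAID EXPONENT** (generic form): if `credits (credit ∘ sh) G + A ≤ credits (pcredit ∘
sh) G` and the realised cost is read below `costT` on the padded life, then `pshapeTH … κ G · e^{A} ≤ shapeTH … G`.
[folklore] -/
theorem pshapeTH_mul_exp_le_shapeTH_of_credits {Δ Λ' : ℝ} (hΔ : 0 ≤ Δ) (hΛ : 0 ≤ Λ') (R : ℕ → ℕ) (g : ℕ → ℝ)
    (K D : ℕ) {κ : Gen ε → ℕ → ℝ} {G : Gen ε} {A : ℝ}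
    (hA : credits (credit C g ∘ sh) G + A ≤ credits (pcredit O C g ∘ sh) G)
    (h : ∀ n ∈ life (padW (dictWT sh R C.n₁) D) G, κ G n ≤ costT sh C K R G n) :
    pshapeTH sh O C Δ Λ' R g D κ G * Real.exp A ≤ shapeTH sh C Δ Λ' R g K D G := by
  unfold pshapeTH shapeTH
  have hc : Real.exp (-credits (pcredit O C g ∘ sh) G) * Real.exp A ≤ Real.exp (-credits (credit C g ∘ sh) G) := by
    rw [← Real.exp_add]; exact Real.exp_le_exp.2 (by linarith)
  have hl : Real.exp (lifeCost (padW (dictWT sh R C.n₁) D) κ G) ≤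
      Real.exp (lifeCost (padW (dictWT sh R C.n₁) D) (costT sh C K R) G) :=
    Real.exp_le_exp.2 (lifeCostT_mono h)
  have hraw : Real.exp (-credits (pcredit O C g ∘ sh) G) * Real.exp (lifeCost (padW (dictWT sh R C.n₁) D) κ G) *
      Real.exp A ≤ Real.exp (-credits (credit C g ∘ sh) G) *
        Real.exp (lifeCost (padW (dictWT sh R C.n₁) D) (costT sh C K R) G) := by
    calc _ = Real.exp (-credits (pcredit O C g ∘ sh) G) * Real.exp A *
          Real.exp (lifeCost (padW (dictWT sh R C.n₁) D) κ G) := by ring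
      _ ≤ _ := mul_le_mul hc hl (Real.exp_pos _).le (Real.exp_pos _).le
  have hpre : 0 ≤ Δ * Λ' ^ partnerAges (PEv.step ∘ sh) G := mul_nonneg hΔ (pow_nonneg hΛ _)
  calc _ = Δ * Λ' ^ partnerAges (PEv.step ∘ sh) G * (Real.exp (-credits (pcredit O C g ∘ sh) G) *
        Real.exp (lifeCost (padW (dictWT sh R C.n₁) D) κ G) * Real.exp A) := by ring
    _ ≤ Δ * Λ' ^ partnerAges (PEv.step ∘ sh) G * (Real.exp (-credits (credit C g ∘ sh) G) *
        Real.exp (lifeCost (padW (dictWT sh R C.n₁) D) (costT sh C K R) G)) :=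
      mul_le_mul_of_nonneg_left hraw hpre
    _ = _ := by ring

/-- **THE TH SHAPE ABSORBS THE MERGER SURCHARGES** paid by the absorbed roots' slack. [folklore] -/
theorem pshapeTH_mul_exp_merges_le_shapeTH (hb : C.a ≤ O.γ₀ * O.A₁ ^ 2 / 2) {Δ Λ' : ℝ} (hΔ : 0 ≤ Δ) (hΛ : 0 ≤ Λ')
    (R : ℕ → ℕ) (g : ℕ → ℝ) (K D : ℕ) {κ : Gen ε → ℕ → ℝ} {G : Gen ε} {σ : ε → ℝ} (hF : FreshT G)
    (hM : MergePaid (fun e => slackT O C g (sh e)) σ G)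
    (h : ∀ n ∈ life (padW (dictWT sh R C.n₁) D) G, κ G n ≤ costT sh C K R G n) :
    pshapeTH sh O C Δ Λ' R g D κ G * Real.exp (∑ e ∈ merges G, σ e) ≤ shapeTH sh C Δ Λ' R g K D G :=
  pshapeTH_mul_exp_le_shapeTH_of_credits sh hΔ hΛ R g K D (creditsT_merges_surcharge_le sh hb g hF hM) h

end Merges

/-! ## §2 The connector instance -/

section Connector

variable {ε : Type*} [DecidableEq ε] {C : T4PrintedShapeBanking.Consts} {O : PrintedO1s} (sh : ε → PEv)

omit [DecidableEq ε] in
/-- **EVERY CONNECTOR IS PAID BY ITS ABSORBED ROOT** under `ConsistentT` (the absorbed root is a birth at a step `j ≤` the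
merger step `s ≤ K`, `ConsistentT.absorbed_spec`) and the displayed two-scale γ-clause
`hcl : ∀ j ≤ s ≤ K, o87·2d·M^d·R_s^{d+1} ≤ (½γ₀A₁² − a)·p₀(g_j)²`: with `σ e := O.connector (R (sh e).step)`,
`MergePaid (slackT ∘ sh) σ G`. [folklore] -/
theorem mergePaid_connector_of_clause (hO : O.Pos) {K : ℕ} {R : ℕ → ℕ} {g : ℕ → ℝ}
    (hcl : ∀ j s, j ≤ s → s ≤ K →
      O.connector (R s) ≤ (O.γ₀ * O.A₁ ^ 2 / 2 - C.a) * p0Profile C.A₀ C.p₀ (g j) ^ 2) :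
    ∀ {G : Gen ε}, ConsistentT sh C K R G →
      MergePaid (fun e => slackT O C g (sh e)) (fun e => O.connector (R (sh e).step)) G
  | Gen.born _ _, _ => trivial
  | Gen.renew G e h, hc => by
      simp only [ConsistentT] at hc
      exact mergePaid_connector_of_clause hO hcl (G := G) hc.1
  | Gen.merge X Y e, hc => by
      have hab := ConsistentT.absorbed_spec hc
      simp only [ConsistentT] at hc
      obtain ⟨hX, hY, -, -, -, -, -, hsK⟩ := hc
      refine ⟨mergePaid_connector_of_clause hO hcl hX, mergePaid_connector_of_clause hO hcl hY, ?_⟩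
      show O.connector (R (sh e).step) ≤ slackT O C g (sh (absorbed X Y))
      rw [slackT_kind0 hab.1]
      have h1 := hcl _ _ hab.2 hsK
      have hB : 0 ≤ O.connector (R (sh e).step) := by
        unfold PrintedO1s.connector; have := hO.o87_pos; have := hO.M_pos; positivity
      have hf : (1 : ℝ) ≤ ((sh (absorbed X Y)).fat : ℝ) + 1 := by
        have : (0 : ℝ) ≤ ((sh (absorbed X Y)).fat : ℝ) := Nat.cast_nonneg _
        linarith
      calc O.connector (R (sh e).step)
          ≤ (O.γ₀ * O.A₁ ^ 2 / 2 - C.a) * p0Profile C.A₀ C.p₀ (g (sh (absorbed X Y)).step) ^ 2 * 1 := by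
            rw [mul_one]; exact h1
        _ ≤ (O.γ₀ * O.A₁ ^ 2 / 2 - C.a) * p0Profile C.A₀ C.p₀ (g (sh (absorbed X Y)).step) ^ 2 *
              (((sh (absorbed X Y)).fat : ℝ) + 1) :=
            mul_le_mul_of_nonneg_left hf (hB.trans h1)

/-- **THE CONNECTOR THRESHOLD** (symbolic): `max 1 (o87·2d·M^d·L^{d+1}·(1+β₀)² ∕ ((½γ₀A₁² − a)·A₀²))`. [folklore] -/
def connectorThreshold (O : PrintedO1s) (C : T4PrintedShapeBanking.Consts) (L : ℕ) (β₀ : ℝ) : ℝ :=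
  max 1 (O.o87 * (2 * O.d) * O.M ^ O.d * (L : ℝ) ^ (O.d + 1) * (1 + β₀) ^ 2 /
    ((O.γ₀ * O.A₁ ^ 2 / 2 - C.a) * C.A₀ ^ 2))

omit [DecidableEq ε] in
/-- **THE TWO-SCALE γ-CLAUSE FROM THE TYPED (2.7), (2.5) AND ONE INFRARED THRESHOLD**: along a run obeying
`B14.FlowIneq27 g β′ β₀ C.p₀ K` (print's (2.7) at exponent `p₀`), at a step `s ≤ K` whose window obeys (2.5) and where
`1 ≤ log g_s⁻²` and `connectorThreshold O C L β₀ ≤ log g_s⁻²`, with STRICT slack `a < ½γ₀A₁²`, `0 < A₀`, `0 ≤ β₀` and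
exponent room `r·(d+1) + 1 ≤ 2p₀`: for every earlier `j ≤ s`,
`o87·2d·M^d·R_s^{d+1} ≤ (½γ₀A₁² − a)·p₀(g_j)²`. [folklore] -/
theorem connectorClause_of_threshold (hO : O.Pos) {L r K : ℕ} (hL : 1 ≤ L) {β' β₀ : ℝ} (hβ : 0 ≤ β₀)
    (hslack : C.a < O.γ₀ * O.A₁ ^ 2 / 2) (hA : 0 < C.A₀) (hexp : r * (O.d + 1) + 1 ≤ 2 * C.p₀)
    {R : ℕ → ℕ} {g : ℕ → ℝ} (h27 : B14.FlowIneq27 g β' β₀ C.p₀ K) {j s : ℕ} (hjs : j ≤ s) (hsK : s ≤ K)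
    (hR : B14.IsRj L r (g s) (R s)) (hx1 : 1 ≤ Real.log ((g s) ^ 2)⁻¹)
    (hthr : connectorThreshold O C L β₀ ≤ Real.log ((g s) ^ 2)⁻¹) :
    O.connector (R s) ≤ (O.γ₀ * O.A₁ ^ 2 / 2 - C.a) * p0Profile C.A₀ C.p₀ (g j) ^ 2 := by
  set x := Real.log ((g s) ^ 2)⁻¹ with hxdef
  set y := Real.log ((g j) ^ 2)⁻¹ with hydef
  have hx0 : 0 ≤ x := zero_le_one.trans hx1
  have hb1 : (1 : ℝ) ≤ (1 + β₀) ^ 2 := by nlinarith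
  have hca : 0 < O.γ₀ * O.A₁ ^ 2 / 2 - C.a := by linarith
  have hcA : 0 < (O.γ₀ * O.A₁ ^ 2 / 2 - C.a) * C.A₀ ^ 2 := mul_pos hca (by positivity)
  have hB0 : 0 ≤ O.o87 * (2 * O.d) * O.M ^ O.d := by
    have := hO.o87_pos; have := hO.M_pos; positivity
  -- (2.5): `R_s^{d+1} ≤ L^{d+1}·x^{r(d+1)}`
  have hRle : (R s : ℝ) ≤ L * x ^ r := B14FlowStep.isRj_le_mul_logpow hL hR (one_le_pow₀ hx1)
  have hRpow : (R s : ℝ) ^ (O.d + 1) ≤ (L : ℝ) ^ (O.d + 1) * x ^ (r * (O.d + 1)) := by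
    rw [pow_mul, ← mul_pow]; exact pow_le_pow_left₀ (Nat.cast_nonneg _) hRle _
  -- the threshold: `B·(1+β₀)² ≤ cA·x^{2p₀ − r(d+1)}` with `B = o87·2d·M^d·L^{d+1}`
  have hn : 1 ≤ 2 * C.p₀ - r * (O.d + 1) := by omega
  have hγ := gammaClause_of_large (B := O.o87 * (2 * O.d) * O.M ^ O.d * (L : ℝ) ^ (O.d + 1) * (1 + β₀) ^ 2) hcA hn
    (by simpa [connectorThreshold] using hthr)
  -- (2.7) at exponent `p₀`: `x^{2p₀} ≤ (1+β₀)²·y^{2p₀}`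
  have h27' : x ^ C.p₀ ≤ (1 + β₀) * y ^ C.p₀ := by
    rcases Nat.lt_or_ge j s with hlt | hge
    · exact (h27 j s hlt hsK).1
    · have : j = s := le_antisymm hjs hge
      subst this
      have hxp : 0 ≤ x ^ C.p₀ := pow_nonneg hx0 _
      nlinarith
  have hsq : x ^ (2 * C.p₀) ≤ (1 + β₀) ^ 2 * y ^ (2 * C.p₀) := by
    have hxp : 0 ≤ x ^ C.p₀ := pow_nonneg hx0 _
    have e1 : x ^ (2 * C.p₀) = (x ^ C.p₀) ^ 2 := by rw [← pow_mul, Nat.mul_comm]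
    have e2 : y ^ (2 * C.p₀) = (y ^ C.p₀) ^ 2 := by rw [← pow_mul, Nat.mul_comm]
    rw [e1, e2, ← mul_pow]
    exact pow_le_pow_left₀ hxp h27' 2
  have hsplit : x ^ (2 * C.p₀) = x ^ (2 * C.p₀ - r * (O.d + 1)) * x ^ (r * (O.d + 1)) := by
    rw [← pow_add]; congr 1; omega
  have hP2 : p0Profile C.A₀ C.p₀ (g j) ^ 2 = C.A₀ ^ 2 * y ^ (2 * C.p₀) := by
    rw [p0Profile, ← hydef, mul_pow, ← pow_mul, Nat.mul_comm]
  have hb0 : (0 : ℝ) < (1 + β₀) ^ 2 := by positivity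
  -- assemble
  have step1 : O.connector (R s) ≤ O.o87 * (2 * O.d) * O.M ^ O.d * (L : ℝ) ^ (O.d + 1) * x ^ (r * (O.d + 1)) := by
    unfold PrintedO1s.connector
    calc O.o87 * (2 * O.d) * O.M ^ O.d * (R s : ℝ) ^ (O.d + 1)
        ≤ O.o87 * (2 * O.d) * O.M ^ O.d * ((L : ℝ) ^ (O.d + 1) * x ^ (r * (O.d + 1))) :=
          mul_le_mul_of_nonneg_left hRpow hB0
      _ = _ := by ring
  have step2 : O.o87 * (2 * O.d) * O.M ^ O.d * (L : ℝ) ^ (O.d + 1) * x ^ (r * (O.d + 1)) * (1 + β₀) ^ 2 ≤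
      (O.γ₀ * O.A₁ ^ 2 / 2 - C.a) * C.A₀ ^ 2 * x ^ (2 * C.p₀) := by
    have := mul_le_mul_of_nonneg_right hγ (pow_nonneg hx0 (r * (O.d + 1)))
    rw [hsplit]
    nlinarith [this]
  have step3 : (O.γ₀ * O.A₁ ^ 2 / 2 - C.a) * C.A₀ ^ 2 * x ^ (2 * C.p₀) ≤
      (O.γ₀ * O.A₁ ^ 2 / 2 - C.a) * C.A₀ ^ 2 * ((1 + β₀) ^ 2 * y ^ (2 * C.p₀)) :=
    mul_le_mul_of_nonneg_left hsq hcA.le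
  have hconn0 : 0 ≤ O.connector (R s) := by
    unfold PrintedO1s.connector; positivity
  rw [hP2]
  nlinarith [step1, step2, step3, hconn0, hb0]

end Connector

/-! ## §3 Sanity -/

namespace Sanity

/-- the connector threshold of the strict-slack toy record `O₂` (`γ₀ = 4`, everything else `1`, `d = 1`) over `C₁` at
`L = 2`, `β₀ = 0`: `max 1 (1·2·1·2²·1 ∕ ((2 − 1)·1)) = 8`, decided. [folklore] -/
example : connectorThreshold O₂ C₁ 2 0 = 8 := by norm_num [connectorThreshold, O₂, C₁]

/-- `MergePaid` on a toy merger with zero surcharge and the (zero) slack budget of the toy pair holds. [folklore] -/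
example : MergePaid (fun e : PEv × ℕ => slackT O₁ C₁ (fun _ => (1 : ℝ) / 2) e.1) (fun _ => 0)
    (Gen.merge Gt (Gen.born (((2, 0, 1) : PEv), 8) 2) (((3, 2, 0) : PEv), 9)) :=
  ⟨trivial, trivial, slackT_nonneg (by norm_num [O₁, C₁]) _ _⟩

end Sanity

end

end Summit.QuantumFields.BalabanUV.T4Continuum.HistoryConstants
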